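import Mathlib.LinearAlgebra.ExteriorPower.Basic
import Mathlib.Analysis.Normed.Algebra.Basic
import Mathlib.Analysis.Normed.Operator.Basic
import Mathlib.Analysis.InnerProductSpace.Basic
import Mathlib.Topology.Order.MonotoneConvergence
import Mathlib.Order.Filter.AtTopBot.Basic
import HarnessLib

/-!
# The second additive compound `A^{[2]}` and the logarithmic (Lozinskiĭ) norm

Topic `Literature/Dynamics/Contraction`; definition request `defn-SecondAdditiveCompound` (route
`Summits/NavierStokesRegularity/…/DulacContraction`, support item `RelativeContractionEngine` =
stmt-NavierStokesRegularity-8569, foreseen child `LinearAreaContraction` of stmt-8559).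

**Sources.**  J. S. Muldowney, *Compound matrices and ordinary differential equations*, Rocky
Mountain J. Math. 20 (1990), §2: for an `n × n` matrix `A` the *second additive compound*
`A^{[2]}` is the `C(n,2) × C(n,2)` matrix with `(x₁ ∧ x₂)' = A^{[2]} (x₁ ∧ x₂)` whenever
`xᵢ' = A xᵢ`; equivalently `A^{[2]} = D (I + hA)^{(2)}|_{h=0}`, the derivative of the second
multiplicative compound; its eigenvalues are the sums `λᵢ + λⱼ`, `i < j`.  M. Y. Li,
J. S. Muldowney, SIAM J. Math. Anal. 27 (1996), §2; C. Wu, I. Kanevskiy, M. Margaliot,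
*`k`-contraction: theory and applications* (arXiv:2008.10321), §2 (compounds) and §3 (the
logarithmic norm / matrix measure `μ(A) = lim_{h → 0⁺} (‖I + hA‖ − 1)/h`, with
`μ(A + B) ≤ μ(A) + μ(B)`, `−‖A‖ ≤ μ(A) ≤ ‖A‖`, `μ(cA) = c μ(A)` for `c ≥ 0`, and in the Euclidean
norm `μ₂(A) = λ_max((A + Aᵀ)/2)`, i.e. `μ₂(A) ≤ c` iff `⟨Ax, x⟩ ≤ c|x|²`).

**Contents** (namespace `Literature.Dynamics.Contraction`), in Mathlib generality:

* `wedge x y = x ∧ y ∈ ⋀[R]^2 M` (Mathlib's `exteriorPower.ιMulti`), bilinear and alternating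
  (`wedge_add_left`, `wedge_smul_left`, `wedge_swap`, `wedge_self`, …), for any module `M` over
  a commutative ring `R`.  (The second MULTIPLICATIVE compound of `f` is Mathlib's
  `exteriorPower.map 2 f`, `map 2 f (x ∧ y) = f x ∧ f y`.)
* `secondAdditiveCompound f : ⋀[R]^2 M →ₗ[R] ⋀[R]^2 M` — **`f^{[2]} (x ∧ y) = f x ∧ y + x ∧ f y`**
  (`secondAdditiveCompound_wedge`), built through the universal property
  (`exteriorPower.alternatingMapLinearEquiv`) from the alternating map `addCompoundAlt f`; it is
  additive and `R`-linear in `f` (`_add`, `_smul`, `_zero`), `id^{[2]} = 2 • id`, it is a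
  derivation / Lie-algebra map (`secondAdditiveCompound_comp_sub_comp`:
  `(fg − gf)^{[2]} = f^{[2]}g^{[2]} − g^{[2]}f^{[2]}`), and the spectral statement in its usable
  direction: eigenvectors `f x = a x`, `f y = b y` give `f^{[2]}(x ∧ y) = (a + b)(x ∧ y)`
  (`secondAdditiveCompound_wedge_of_eigen`; in finite dimensions over an algebraically closed
  field these exhaust the spectrum, `σ(A^{[2]}) = {λᵢ + λⱼ : i < j}`, Muldowney §2 — the converse
  inclusion needs a triangularising basis of `⋀²` and is not proved here).
* `logNorm a = μ(a) := inf_{h > 0} (‖1 + h a‖ − 1)/h` for an element `a` of a real normed algebra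
  `𝔸` (e.g. `E →L[ℝ] E`, or matrices with any submultiplicative operator norm): the difference
  quotient is MONOTONE in `h` (`logNormQuot_mono`, convexity), so the infimum is the printed
  one-sided limit (`tendsto_logNormQuot`); `−‖a‖ ≤ μ(a) ≤ ‖a‖`, `μ(0) = 0`, subadditivity
  `μ(a + b) ≤ μ(a) + μ(b)` (`logNorm_add_le`), positive homogeneity (`logNorm_smul`), and the
  Hilbert-space criterion `⟨Ax, x⟩ ≤ c‖x‖² ⇒ μ(A) ≤ c` (`logNorm_le_of_inner_le`, the easy half
  of `μ₂ = λ_max((A + Aᵀ)/2)`).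

**Not delivered (recorded for the planner; each is a theorem, not a definition).**  (i) The ODE
identity `d/dt (x₁ ∧ x₂) = A(t)^{[2]} (x₁ ∧ x₂)` and the `2`-volume decay lemma need a norm /
inner product on `⋀² H` (the Gram inner product `⟨x ∧ y, u ∧ v⟩ = det [⟨x,u⟩ ⟨x,v⟩; ⟨y,u⟩ ⟨y,v⟩]`),
which Mathlib does not have on `exteriorPower`; algebraically the identity IS
`secondAdditiveCompound_wedge` applied to `(x₁ ∧ x₂)' = x₁' ∧ x₂ + x₁ ∧ x₂'`.  (ii) The growth bound
`‖e^{ta}‖ ≤ e^{t μ(a)}` (Dahlquist–Lozinskiĭ) needs either the Euler product formula for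
`NormedSpace.exp` or a Dini-derivative Grönwall argument.  (iii) Leonov's varying-metric
expression `μ(Q̇Q⁻¹ + Q A^{[2]} Q⁻¹)` is `logNorm` of a conjugated element once (i) is in place.

## Mathlib search

`exteriorPower` with `ιMulti`, `map` (multiplicative compounds), `linearMap_ext`,
`alternatingMapLinearEquiv` (`LinearAlgebra/ExteriorPower/Basic.lean`); `AlternatingMap.map_swap`,
`map_vecCons_add/smul`; normed algebras, `NormOneClass`; `MonotoneOn.tendsto_nhdsGT`-type
monotone convergence.  No compound matrices, additive compounds or logarithmic norms
(`lean search 'logNorm|lozinski|additiveCompound|compoundMatrix|matrixMeasure'`: nothing).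
Nothing here duplicates an existing declaration; no named fact is introduced.

## References

* J. S. Muldowney, *Compound matrices and ordinary differential equations*, Rocky Mountain J.
  Math. 20 (1990) 857–872, §2. [Muldowney1990]
* M. Y. Li, J. S. Muldowney, *A geometric approach to global-stability problems*, SIAM J. Math.
  Anal. 27 (1996) 1070–1083, §2. [LiMuldowney1996]
* C. Wu, I. Kanevskiy, M. Margaliot, *`k`-contraction: theory and applications*,
  arXiv:2008.10321, §§2–3. [WuKanevskiyMargaliot2020]
* N. V. Kuznetsov, V. Reitmann, *Attractor Dimension Estimates for Dynamical Systems*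
  (Springer 2021), Ch. 5. [KuznetsovReitmann2021]
-/

noncomputable section

open scoped Topology Pointwise
open Set Filter exteriorPower

namespace Literature.Dynamics.Contraction

/-! ### Wedges of two vectors in `⋀[R]^2 M` -/

section Algebra

variable {R : Type*} [CommRing R] {M : Type*} [AddCommGroup M] [Module R M]

/-- The wedge `x ∧ y ∈ ⋀[R]^2 M` of two vectors (Mathlib's `ιMulti R 2 ![x, y]`).
[cite: Muldowney1990, §2] -/
def wedge (x y : M) : ⋀[R]^2 M := ιMulti R 2 ![x, y]

/-- Unfolding lemma for `wedge`. [folklore] -/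
theorem wedge_def (x y : M) : wedge (R := R) x y = ιMulti R 2 ![x, y] := rfl

/-- `(x + x') ∧ y = x ∧ y + x' ∧ y`. [folklore] -/
theorem wedge_add_left (x x' y : M) : wedge (R := R) (x + x') y = wedge x y + wedge x' y :=
  AlternatingMap.map_vecCons_add _ ![y] x x'

/-- `(c • x) ∧ y = c • (x ∧ y)`. [folklore] -/
theorem wedge_smul_left (c : R) (x y : M) : wedge (R := R) (c • x) y = c • wedge x y :=
  AlternatingMap.map_vecCons_smul _ ![y] c x

/-- `x ∧ y = −(y ∧ x)`. [folklore] -/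
theorem wedge_swap (x y : M) : wedge (R := R) x y = -wedge y x := by
  have h := AlternatingMap.map_swap (ιMulti R 2 (M := M)) ![y, x] (i := 0) (j := 1) (by decide)
  have hv : (![y, x] : Fin 2 → M) ∘ Equiv.swap 0 1 = ![x, y] := by
    funext i
    fin_cases i <;> rfl
  rw [hv] at h
  exact h

/-- `x ∧ (y + y') = x ∧ y + x ∧ y'`. [folklore] -/
theorem wedge_add_right (x y y' : M) : wedge (R := R) x (y + y') = wedge x y + wedge x y' := by
  rw [wedge_swap, wedge_add_left, neg_add, ← wedge_swap, ← wedge_swap]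

/-- `x ∧ (c • y) = c • (x ∧ y)`. [folklore] -/
theorem wedge_smul_right (c : R) (x y : M) : wedge (R := R) x (c • y) = c • wedge x y := by
  rw [wedge_swap, wedge_smul_left, wedge_swap x y, smul_neg]

/-- `x ∧ x = 0`. [folklore] -/
theorem wedge_self (x : M) : wedge (R := R) x x = 0 :=
  AlternatingMap.map_eq_zero_of_eq _ ![x, x] (i := 0) (j := 1) rfl (by decide)

/-- `(−x) ∧ y = −(x ∧ y)`. [folklore] -/
theorem wedge_neg_left (x y : M) : wedge (R := R) (-x) y = -wedge x y := by
  rw [← neg_one_smul R x, wedge_smul_left]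
  exact neg_one_smul R (wedge (R := R) x y)

/-- `x ∧ (−y) = −(x ∧ y)`. [folklore] -/
theorem wedge_neg_right (x y : M) : wedge (R := R) x (-y) = -wedge x y := by
  rw [← neg_one_smul R y, wedge_smul_right]
  exact neg_one_smul R (wedge (R := R) x y)

/-- `(x − x') ∧ y = x ∧ y − x' ∧ y`. [folklore] -/
theorem wedge_sub_left (x x' y : M) : wedge (R := R) (x - x') y = wedge x y - wedge x' y := by
  rw [sub_eq_add_neg, wedge_add_left, wedge_neg_left, ← sub_eq_add_neg]

/-- `x ∧ (y − y') = x ∧ y − x ∧ y'`. [folklore] -/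
theorem wedge_sub_right (x y y' : M) : wedge (R := R) x (y - y') = wedge x y - wedge x y' := by
  rw [sub_eq_add_neg, wedge_add_right, wedge_neg_right, ← sub_eq_add_neg]

/-- `x ∧ 0 = 0`. [folklore] -/
theorem wedge_zero_right (x : M) : wedge (R := R) x 0 = 0 := by
  simpa using wedge_smul_right (R := R) 0 x 0

/-- `0 ∧ y = 0`. [folklore] -/
theorem wedge_zero_left (y : M) : wedge (R := R) 0 y = 0 := by
  simpa using wedge_smul_left (R := R) 0 0 y

/-- The second multiplicative compound of Mathlib acts by `f x ∧ f y`. [cite: Muldowney1990, §2] -/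
theorem map_two_wedge (f : M →ₗ[R] M) (x y : M) :
    exteriorPower.map 2 f (wedge x y) = wedge (f x) (f y) := by
  rw [wedge_def, exteriorPower.map_apply_ιMulti]
  congr 1
  funext i
  fin_cases i <;> rfl

/-! ### The second additive compound -/

/-- The alternating bilinear map `(x, y) ↦ f x ∧ y + x ∧ f y` defining `f^{[2]}`.
[cite: Muldowney1990, §2] -/
def addCompoundAlt (f : M →ₗ[R] M) : M [⋀^Fin 2]→ₗ[R] ⋀[R]^2 M where
  toFun v := wedge (f (v 0)) (v 1) + wedge (v 0) (f (v 1))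
  map_update_add' v i x y := by
    fin_cases i
    · simp only [Fin.zero_eta, Function.update_self, ne_eq, one_ne_zero, not_false_eq_true,
        Function.update_of_ne, map_add, wedge_add_left]
      abel
    · simp only [Fin.mk_one, Function.update_self, ne_eq, zero_ne_one, not_false_eq_true,
        Function.update_of_ne, map_add, wedge_add_right]
      abel
  map_update_smul' v i c x := by
    fin_cases i
    · simp only [Fin.zero_eta, Function.update_self, ne_eq, one_ne_zero, not_false_eq_true,
        Function.update_of_ne, map_smul, wedge_smul_left, smul_add]
    · simp only [Fin.mk_one, Function.update_self, ne_eq, zero_ne_one, not_false_eq_true,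
        Function.update_of_ne, map_smul, wedge_smul_right, smul_add]
  map_eq_zero_of_eq' v i j hij hne := by
    have h01 : v 0 = v 1 := by
      fin_cases i <;> fin_cases j
      · exact absurd rfl hne
      · exact hij
      · exact hij.symm
      · exact absurd rfl hne
    simp only [h01]
    rw [wedge_swap (v 1) (f (v 1)), add_neg_cancel]

/-- **The second additive compound `f^{[2]}`** of a linear endomorphism `f` of `M`: the linear
endomorphism of `⋀[R]^2 M` with `f^{[2]}(x ∧ y) = f x ∧ y + x ∧ f y` — the derivative at `h = 0`
of the multiplicative compounds `(1 + h f)^{(2)}`, i.e. the generator of `t ↦ (e^{tf})^{(2)}`;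
for `M = ℝⁿ` it is Muldowney's `C(n,2) × C(n,2)` matrix `A^{[2]}`.
[cite: Muldowney1990, §2] [cite: WuKanevskiyMargaliot2020, §2] -/
def secondAdditiveCompound (f : M →ₗ[R] M) : ⋀[R]^2 M →ₗ[R] ⋀[R]^2 M :=
  alternatingMapLinearEquiv (addCompoundAlt f)

/-- **`f^{[2]}(x ∧ y) = f x ∧ y + x ∧ f y`.** [cite: Muldowney1990, §2] -/
@[simp] theorem secondAdditiveCompound_wedge (f : M →ₗ[R] M) (x y : M) :
    secondAdditiveCompound f (wedge x y) = wedge (f x) y + wedge x (f y) :=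
  alternatingMapLinearEquiv_apply_ιMulti (addCompoundAlt f) ![x, y]

/-- Two linear maps out of `⋀[R]^2 M` agreeing on wedges are equal. [folklore] -/
theorem hom_ext_wedge {N : Type*} [AddCommGroup N] [Module R N] {F G : ⋀[R]^2 M →ₗ[R] N}
    (h : ∀ x y : M, F (wedge x y) = G (wedge x y)) : F = G := by
  refine linearMap_ext ?_
  ext v
  have hv : v = ![v 0, v 1] := by
    funext i; fin_cases i <;> rfl
  simp only [LinearMap.compAlternatingMap_apply]
  rw [hv]
  exact h (v 0) (v 1)

/-- `(f + g)^{[2]} = f^{[2]} + g^{[2]}`. [cite: WuKanevskiyMargaliot2020, §2] -/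
theorem secondAdditiveCompound_add (f g : M →ₗ[R] M) :
    secondAdditiveCompound (f + g) = secondAdditiveCompound f + secondAdditiveCompound g := by
  refine hom_ext_wedge fun x y => ?_
  simp only [secondAdditiveCompound_wedge, LinearMap.add_apply, wedge_add_left, wedge_add_right]
  abel

/-- `(c • f)^{[2]} = c • f^{[2]}`. [cite: WuKanevskiyMargaliot2020, §2] -/
theorem secondAdditiveCompound_smul (c : R) (f : M →ₗ[R] M) :
    secondAdditiveCompound (c • f) = c • secondAdditiveCompound f := by
  refine hom_ext_wedge fun x y => ?_
  simp only [secondAdditiveCompound_wedge, LinearMap.smul_apply, wedge_smul_left, wedge_smul_right,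
    smul_add]

/-- `0^{[2]} = 0`. [folklore] -/
theorem secondAdditiveCompound_zero : secondAdditiveCompound (0 : M →ₗ[R] M) = 0 := by
  refine hom_ext_wedge fun x y => ?_
  simp only [secondAdditiveCompound_wedge, LinearMap.zero_apply, wedge_zero_left, wedge_zero_right,
    add_zero]

/-- `id^{[2]} = 2 • id` (`x ∧ y ↦ 2 (x ∧ y)`; in general `(tr)`: `I^{[k]} = k I`).
[cite: WuKanevskiyMargaliot2020, §2] -/
theorem secondAdditiveCompound_id :
    secondAdditiveCompound (LinearMap.id : M →ₗ[R] M) = (2 : R) • LinearMap.id := by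
  refine hom_ext_wedge fun x y => ?_
  simp only [secondAdditiveCompound_wedge, LinearMap.id_apply, LinearMap.add_apply, two_smul]

/-- **`f ↦ f^{[2]}` is a Lie-algebra map**: `(f g − g f)^{[2]} = f^{[2]} g^{[2]} − g^{[2]} f^{[2]}`
(the infinitesimal form of the multiplicativity `(AB)^{(2)} = A^{(2)} B^{(2)}` of compounds).
[cite: Muldowney1990, §2] -/
theorem secondAdditiveCompound_comp_sub_comp (f g : M →ₗ[R] M) :
    secondAdditiveCompound (f ∘ₗ g - g ∘ₗ f) =
      secondAdditiveCompound f ∘ₗ secondAdditiveCompound g -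
        secondAdditiveCompound g ∘ₗ secondAdditiveCompound f := by
  refine hom_ext_wedge fun x y => ?_
  simp only [secondAdditiveCompound_wedge, LinearMap.sub_apply, LinearMap.comp_apply, map_add,
    wedge_sub_left, wedge_sub_right]
  abel

/-- **Eigenvalues add**: if `f x = a x` and `f y = b y` then `f^{[2]}(x ∧ y) = (a + b)(x ∧ y)` — the
eigenvalues of `A^{[2]}` are the sums `λᵢ + λⱼ`, `i < j`, of eigenvalues of `A` (this direction;
for the converse see the module docstring). [cite: Muldowney1990, §2] -/
theorem secondAdditiveCompound_wedge_of_eigen (f : M →ₗ[R] M) {x y : M} {a b : R}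
    (hx : f x = a • x) (hy : f y = b • y) :
    secondAdditiveCompound f (wedge x y) = (a + b) • wedge x y := by
  rw [secondAdditiveCompound_wedge, hx, hy, wedge_smul_left, wedge_smul_right, add_smul]

end Algebra

/-! ### The logarithmic norm (Lozinskiĭ measure) -/

section LogNorm

variable {𝔸 : Type*} [NormedRing 𝔸] [NormedAlgebra ℝ 𝔸]

/-- The difference quotient `q_a(h) = (‖1 + h a‖ − 1)/h` whose limit as `h → 0⁺` is the logarithmic
norm. [cite: WuKanevskiyMargaliot2020, §3] -/
def logNormQuot (a : 𝔸) (h : ℝ) : ℝ := (‖(1 : 𝔸) + h • a‖ - 1) / h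

/-- **The logarithmic norm** (matrix measure, Lozinskiĭ / Dahlquist 1958)
`μ(a) = lim_{h → 0⁺} (‖1 + h a‖ − 1)/h` of an element of a real normed algebra (a bounded operator
`E →L[ℝ] E`, a matrix with an operator norm, …).  Defined as the infimum of the difference
quotients over `h > 0`, which is the printed limit because the quotient is monotone in `h`
(`logNormQuot_mono`, `tendsto_logNormQuot`; these need `‖1‖ = 1`). [cite: WuKanevskiyMargaliot2020, §3] -/
def logNorm (a : 𝔸) : ℝ := sInf (logNormQuot a '' Ioi 0)

variable [NormOneClass 𝔸]

/-- **Convexity: the difference quotient is non-decreasing in `h > 0`** — for `0 < h ≤ k`,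
`1 + h a = (h/k)(1 + k a) + (1 − h/k) 1`, so `‖1 + h a‖ − 1 ≤ (h/k)(‖1 + k a‖ − 1)`.
[cite: WuKanevskiyMargaliot2020, §3] -/
theorem logNormQuot_mono (a : 𝔸) : MonotoneOn (logNormQuot a) (Ioi 0) := by
  intro h hh k hk hhk
  have hh0 : (0 : ℝ) < h := hh
  have hk0 : (0 : ℝ) < k := hk
  have hconv : (1 : 𝔸) + h • a = (h / k) • ((1 : 𝔸) + k • a) + (1 - h / k) • (1 : 𝔸) := by
    rw [smul_add, smul_smul, div_mul_cancel₀ h hk0.ne', sub_smul, one_smul]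
    abel
  have hle : h / k ≤ 1 := (div_le_one hk0).mpr hhk
  have hnorm : ‖(1 : 𝔸) + h • a‖ ≤ h / k * ‖(1 : 𝔸) + k • a‖ + (1 - h / k) := by
    calc ‖(1 : 𝔸) + h • a‖ = ‖(h / k) • ((1 : 𝔸) + k • a) + (1 - h / k) • (1 : 𝔸)‖ := by
          rw [← hconv]
      _ ≤ ‖(h / k) • ((1 : 𝔸) + k • a)‖ + ‖(1 - h / k) • (1 : 𝔸)‖ := norm_add_le _ _
      _ = h / k * ‖(1 : 𝔸) + k • a‖ + (1 - h / k) := by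
          rw [norm_smul, norm_smul, Real.norm_of_nonneg (by positivity),
            Real.norm_of_nonneg (by linarith), norm_one, mul_one]
  have hmul : k * (‖(1 : 𝔸) + h • a‖ - 1) ≤ h * (‖(1 : 𝔸) + k • a‖ - 1) := by
    have h1 : ‖(1 : 𝔸) + h • a‖ - 1 ≤ h / k * (‖(1 : 𝔸) + k • a‖ - 1) := by linarith
    have h2 := mul_le_mul_of_nonneg_left h1 hk0.le
    calc k * (‖(1 : 𝔸) + h • a‖ - 1) ≤ k * (h / k * (‖(1 : 𝔸) + k • a‖ - 1)) := h2
      _ = h * (‖(1 : 𝔸) + k • a‖ - 1) := by rw [← mul_assoc, mul_div_cancel₀ _ hk0.ne']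
  unfold logNormQuot
  rw [div_le_div_iff₀ hh0 hk0]
  linarith

/-- `q_a(h) ≤ ‖a‖` for `h > 0` (`‖1 + h a‖ ≤ 1 + h‖a‖`). [cite: WuKanevskiyMargaliot2020, §3] -/
theorem logNormQuot_le_norm (a : 𝔸) {h : ℝ} (hh : 0 < h) : logNormQuot a h ≤ ‖a‖ := by
  unfold logNormQuot
  rw [div_le_iff₀ hh]
  have : ‖(1 : 𝔸) + h • a‖ ≤ 1 + h * ‖a‖ := by
    calc ‖(1 : 𝔸) + h • a‖ ≤ ‖(1 : 𝔸)‖ + ‖h • a‖ := norm_add_le _ _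
      _ = 1 + h * ‖a‖ := by rw [norm_one, norm_smul, Real.norm_of_nonneg hh.le]
  linarith

/-- `−‖a‖ ≤ q_a(h)` for `h > 0` (`‖1 + h a‖ ≥ 1 − h‖a‖`). [cite: WuKanevskiyMargaliot2020, §3] -/
theorem neg_norm_le_logNormQuot (a : 𝔸) {h : ℝ} (hh : 0 < h) : -‖a‖ ≤ logNormQuot a h := by
  unfold logNormQuot
  rw [le_div_iff₀ hh]
  have : (1 : ℝ) ≤ ‖(1 : 𝔸) + h • a‖ + h * ‖a‖ := by
    calc (1 : ℝ) = ‖(1 : 𝔸)‖ := norm_one.symm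
      _ = ‖((1 : 𝔸) + h • a) - h • a‖ := by rw [add_sub_cancel_right]
      _ ≤ ‖(1 : 𝔸) + h • a‖ + ‖h • a‖ := norm_sub_le _ _
      _ = ‖(1 : 𝔸) + h • a‖ + h * ‖a‖ := by rw [norm_smul, Real.norm_of_nonneg hh.le]
  linarith

/-- The difference quotients are bounded below (by `−‖a‖`). [folklore] -/
theorem bddBelow_logNormQuot (a : 𝔸) : BddBelow (logNormQuot a '' Ioi 0) :=
  ⟨-‖a‖, by rintro _ ⟨h, hh, rfl⟩; exact neg_norm_le_logNormQuot a hh⟩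

/-- `μ(a) ≤ q_a(h)` for every `h > 0` (the infimum is a lower bound). [cite: WuKanevskiyMargaliot2020, §3] -/
theorem logNorm_le_logNormQuot (a : 𝔸) {h : ℝ} (hh : 0 < h) : logNorm a ≤ logNormQuot a h :=
  csInf_le (bddBelow_logNormQuot a) ⟨h, hh, rfl⟩

/-- `μ(a) ≤ ‖a‖`. [cite: WuKanevskiyMargaliot2020, §3] -/
theorem logNorm_le_norm (a : 𝔸) : logNorm a ≤ ‖a‖ :=
  (logNorm_le_logNormQuot a one_pos).trans (logNormQuot_le_norm a one_pos)

/-- `−‖a‖ ≤ μ(a)`. [cite: WuKanevskiyMargaliot2020, §3] -/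
theorem neg_norm_le_logNorm (a : 𝔸) : -‖a‖ ≤ logNorm a :=
  le_csInf ⟨_, 1, mem_Ioi.mpr one_pos, rfl⟩
    (by rintro _ ⟨h, hh, rfl⟩; exact neg_norm_le_logNormQuot a hh)

/-- **The printed definition: `q_a(h) → μ(a)` as `h → 0⁺`** (monotone convergence).
[cite: WuKanevskiyMargaliot2020, §3] -/
theorem tendsto_logNormQuot (a : 𝔸) : Tendsto (logNormQuot a) (𝓝[>] 0) (𝓝 (logNorm a)) :=
  (logNormQuot_mono a).tendsto_nhdsGT (bddBelow_logNormQuot a)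

/-- `μ(0) = 0`. [folklore] -/
theorem logNorm_zero : logNorm (0 : 𝔸) = 0 := by
  have h : logNormQuot (0 : 𝔸) '' Ioi 0 = {0} := by
    ext x
    simp only [mem_image, mem_Ioi, mem_singleton_iff, logNormQuot, smul_zero, add_zero, norm_one,
      sub_self, zero_div]
    exact ⟨fun ⟨_, _, hx⟩ => hx.symm, fun hx => ⟨1, one_pos, hx.symm⟩⟩
  rw [logNorm, h, csInf_singleton]

/-- **Subadditivity `μ(a + b) ≤ μ(a) + μ(b)`**: `1 + h(a + b) = ½(1 + 2h a) + ½(1 + 2h b)` gives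
`q_{a+b}(h) ≤ q_a(2h) + q_b(2h)`, and both right-hand quotients tend to the logarithmic norms.
[cite: WuKanevskiyMargaliot2020, §3] -/
theorem logNorm_add_le (a b : 𝔸) : logNorm (a + b) ≤ logNorm a + logNorm b := by
  -- pointwise inequality of quotients
  have hq : ∀ h : ℝ, 0 < h → logNormQuot (a + b) h ≤ logNormQuot a (2 * h) + logNormQuot b (2 * h) := by
    intro h hh
    have hconv : (1 : 𝔸) + h • (a + b) =
        (1 / 2 : ℝ) • ((1 : 𝔸) + (2 * h) • a) + (1 / 2 : ℝ) • ((1 : 𝔸) + (2 * h) • b) := by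
      module
    have hnorm : ‖(1 : 𝔸) + h • (a + b)‖ ≤
        1 / 2 * ‖(1 : 𝔸) + (2 * h) • a‖ + 1 / 2 * ‖(1 : 𝔸) + (2 * h) • b‖ := by
      rw [hconv]
      refine (norm_add_le _ _).trans (le_of_eq ?_)
      rw [norm_smul, norm_smul, Real.norm_of_nonneg (by norm_num)]
    unfold logNormQuot
    rw [← add_div, div_le_div_iff₀ hh (by linarith)]
    nlinarith [hnorm, hh.le]
  -- pass to the limit `h → 0⁺`
  have hlim2 : ∀ c : 𝔸, Tendsto (fun h => logNormQuot c (2 * h)) (𝓝[>] 0) (𝓝 (logNorm c)) := by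
    intro c
    refine (tendsto_logNormQuot c).comp ?_
    refine tendsto_nhdsWithin_of_tendsto_nhds_of_eventually_within _ ?_ ?_
    · have : Tendsto (fun h : ℝ => 2 * h) (𝓝 0) (𝓝 (2 * 0)) :=
        (continuous_const.mul continuous_id).tendsto 0
      rw [mul_zero] at this
      exact this.mono_left nhdsWithin_le_nhds
    · filter_upwards [self_mem_nhdsWithin] with h hh
      exact mul_pos two_pos (mem_Ioi.mp hh)
  refine le_of_tendsto_of_tendsto (tendsto_logNormQuot (a + b)) ((hlim2 a).add (hlim2 b)) ?_
  filter_upwards [self_mem_nhdsWithin] with h hh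
  exact hq h (mem_Ioi.mp hh)

omit [NormOneClass 𝔸] in
/-- **Positive homogeneity `μ(c a) = c μ(a)`** for `c > 0` (`q_{ca}(h) = c q_a(c h)`).
[cite: WuKanevskiyMargaliot2020, §3] -/
theorem logNorm_smul (a : 𝔸) {c : ℝ} (hc : 0 < c) : logNorm (c • a) = c * logNorm a := by
  have hq : ∀ h : ℝ, logNormQuot (c • a) h = c * logNormQuot a (c * h) := by
    intro h
    unfold logNormQuot
    rw [smul_smul, mul_comm h c, ← mul_div_assoc, mul_div_mul_left _ _ hc.ne']
  have himage : logNormQuot (c • a) '' Ioi 0 = c • (logNormQuot a '' Ioi 0) := by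
    ext x
    simp only [mem_image, mem_Ioi, Set.mem_smul_set, smul_eq_mul]
    constructor
    · rintro ⟨h, hh, rfl⟩
      exact ⟨logNormQuot a (c * h), ⟨c * h, mul_pos hc (mem_Ioi.mp hh), rfl⟩, (hq h).symm⟩
    · rintro ⟨_, ⟨k, hk, rfl⟩, rfl⟩
      refine ⟨k / c, mem_Ioi.mpr (div_pos (mem_Ioi.mp hk) hc), ?_⟩
      rw [hq, mul_div_cancel₀ _ hc.ne']
  rw [logNorm, himage, logNorm, Real.sInf_smul_of_nonneg hc.le, smul_eq_mul]

end LogNorm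

section Hilbert

variable {E : Type*} [NormedAddCommGroup E] [InnerProductSpace ℝ E] [Nontrivial E]

open scoped InnerProductSpace

/-- **The Euclidean criterion (easy half of `μ₂(A) = λ_max((A + Aᵀ)/2)`)**: if
`⟨A x, x⟩ ≤ c‖x‖²` for all `x` then `μ(A) ≤ c`, since
`‖(1 + hA)x‖² = ‖x‖² + 2h⟨Ax, x⟩ + h²‖Ax‖² ≤ (1 + hc + h²‖A‖²)²‖x‖²` for `h` small.
[cite: WuKanevskiyMargaliot2020, §3] -/
theorem logNorm_le_of_inner_le (A : E →L[ℝ] E) {c : ℝ} (hA : ∀ x : E, ⟪A x, x⟫_ℝ ≤ c * ‖x‖ ^ 2) :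
    logNorm A ≤ c := by
  -- for every `ε > 0`, eventually `q_A(h) ≤ c + ε`
  refine le_of_forall_pos_lt_add fun ε hε => ?_
  -- choose `h > 0` with `h ‖A‖² ≤ ε` and `0 ≤ 1 + h c`
  obtain ⟨h, hh, hhε, hhc⟩ : ∃ h : ℝ, 0 < h ∧ h * ‖A‖ ^ 2 ≤ ε / 2 ∧ 0 ≤ 1 + h * c := by
    refine ⟨min (ε / 2 / (‖A‖ ^ 2 + 1)) (1 / (|c| + 1)), ?_, ?_, ?_⟩
    · positivity
    · calc min (ε / 2 / (‖A‖ ^ 2 + 1)) (1 / (|c| + 1)) * ‖A‖ ^ 2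
          ≤ ε / 2 / (‖A‖ ^ 2 + 1) * ‖A‖ ^ 2 := by gcongr; exact min_le_left _ _
        _ ≤ ε / 2 / (‖A‖ ^ 2 + 1) * (‖A‖ ^ 2 + 1) := by gcongr; linarith
        _ = ε / 2 := div_mul_cancel₀ _ (by positivity)
    · have h1 : min (ε / 2 / (‖A‖ ^ 2 + 1)) (1 / (|c| + 1)) * |c| ≤ 1 := by
        calc min (ε / 2 / (‖A‖ ^ 2 + 1)) (1 / (|c| + 1)) * |c| ≤ 1 / (|c| + 1) * |c| := by
              gcongr; exact min_le_right _ _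
          _ ≤ 1 / (|c| + 1) * (|c| + 1) := by gcongr; linarith
          _ = 1 := div_mul_cancel₀ _ (by positivity)
      have h2 : 0 ≤ min (ε / 2 / (‖A‖ ^ 2 + 1)) (1 / (|c| + 1)) := by positivity
      nlinarith [neg_abs_le c, h2, abs_nonneg c]
  -- the operator-norm bound `‖1 + hA‖ ≤ 1 + hc + h²‖A‖²`
  set b : ℝ := 1 + h * c + h ^ 2 * ‖A‖ ^ 2 with hb
  have hb0 : 0 ≤ b := by positivity
  have hop : ‖(1 : E →L[ℝ] E) + h • A‖ ≤ b := by
    refine ContinuousLinearMap.opNorm_le_bound _ hb0 fun x => ?_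
    have hx : ((1 : E →L[ℝ] E) + h • A) x = x + h • A x := rfl
    rw [hx]
    have hsq : ‖x + h • A x‖ ^ 2 ≤ (b * ‖x‖) ^ 2 := by
      rw [norm_add_sq_real, real_inner_smul_right, real_inner_comm, norm_smul,
        Real.norm_of_nonneg hh.le]
      have h1 : ⟪A x, x⟫_ℝ ≤ c * ‖x‖ ^ 2 := hA x
      have h2 : ‖A x‖ ≤ ‖A‖ * ‖x‖ := A.le_opNorm x
      have h3 : 0 ≤ ‖A x‖ := norm_nonneg _
      have h4 : 0 ≤ ‖x‖ := norm_nonneg _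
      have h5 : (h * ‖A x‖) ^ 2 ≤ (h * (‖A‖ * ‖x‖)) ^ 2 := by gcongr
      have key : ‖x‖ ^ 2 + 2 * (h * (c * ‖x‖ ^ 2)) + (h * (‖A‖ * ‖x‖)) ^ 2 ≤ (b * ‖x‖) ^ 2 := by
        rw [hb]
        nlinarith [sq_nonneg (h * c + h ^ 2 * ‖A‖ ^ 2), sq_nonneg ‖x‖,
          mul_nonneg (sq_nonneg ‖x‖) (sq_nonneg (h * ‖A‖)), hh.le]
      nlinarith [mul_le_mul_of_nonneg_left h1 (by positivity : (0 : ℝ) ≤ 2 * h)]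
    exact (pow_le_pow_iff_left₀ (norm_nonneg _) (by positivity) two_ne_zero).mp hsq
  calc logNorm A ≤ logNormQuot A h := logNorm_le_logNormQuot A hh
    _ ≤ (b - 1) / h := by
        unfold logNormQuot
        gcongr
    _ = c + h * ‖A‖ ^ 2 := by rw [hb]; field_simp; ring
    _ < c + ε := by linarith

end Hilbert

end Literature.Dynamics.Contraction
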